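import Summits.Ventures.HSemireg.WedgeHankelRecurrenceGaussShiftInterlace

/-!
# Venture HSemireg — **CHRISTOFFEL'S KERNEL-POLYNOMIAL NODES, SAME ORDER**: if `Σ_l ν_l w_l^p = Σ_j μ_j (v_j − c) v_j^p` for `p ≤ 2t + 2` and
# `Σ_j μ_j (v_j − c) v_j^{2t+3} < Σ_l ν_l w_l^{2t+3}` (`t + 2` atoms on each side, `μ_j > 0`, `c < v_j`, `v`, `w` strictly increasing), then
# `v_0 < w_0 < v_1 < w_1 < ⋯ < v_{t+1} < w_{t+1}` — the zeros of the `(t+2)`-nd orthogonal polynomial of `(x − c)σ` (kernel polynomial `K_{t+2}(c; x)`) interlace FROM THE RIGHT with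
# those of the `(t+2)`-nd orthogonal polynomial of `σ`; two-term relation in the N262 style, NO integrating measure needed (the one strict inequality carries all the positivity), plus
# the measure-level version in which every hypothesis except positivity of the big measure is derived (N264 ∕ N265 ∕ N266)

HONEST FRAMING. Part of the Lean index of the computation cell `pub-hsemireg` (seat p10 gen 42, Sunday typer «UNIFORM-IN-n»).  Real polynomials, finite sums and the intermediate
value theorem only (N239 `exists_root_Ioo_of_mul_eval_neg`, N262 `sum_mul_eval_eq_of_moments_eq` ∕ `eval_gapPoly_mul_eval_gapPoly_pos`); no variety, no cohomology theory, no sheaf, no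
Ext group and no semiregularity map is constructed here; nothing here says that HC / HC_CM / HC_AV holds; no Literature fact (unproved `Prop`) is declared or used.  Custodian versions as in
`WedgeHankelSiegelIdeal` (1/3).
SOURCES (cited).  G. Szegő, *Orthogonal Polynomials*, AMS Colloq. Publ. 23, Thm 2.5 (Christoffel's formula) and §3.3; T. S. Chihara, *An Introduction to Orthogonal Polynomials* (1978),
Ch. I §7 (kernel polynomials: for `c` left of the true interval of orthogonality the zeros `x*_{n,k}` of `K_n(c; x)` satisfy `x_{n,k} < x*_{n,k} < x_{n,k+1}`); M. G. Krein,
A. A. Nudel'man, *The Markov Moment Problem and Extremal Problems* (1977), Ch. III.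
PROOF TYPED HERE.  (1) For `deg F ≤ 2t + 3` the two functionals differ by `[X^{2t+3}]F · D`, `D > 0` the given defect.  (2) With `Q = ∏_l (X − w_l)` and the gap polynomial `r_k` of
`v` (degree `t`), `Q r_k` has degree `2t + 2`: `0 = Σ_l ν_l (Q r_k)(w_l) = μ_a (v_a − c) Q(v_a) r_k(v_a) + μ_b (v_b − c) Q(v_b) r_k(v_b)` for adjacent `a, b`; `r_k(v_a) r_k(v_b) > 0`.
(3) If every `Q(v_j)` vanished, `F = Q · X^{t+1}` would give `D = 0`; vanishing propagates, so no `Q(v_j)` vanishes and `Q` alternates strictly along `v`.  (4) `v_0 < w_0`: else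
`F = (X − w_0) ∏_{l ≠ 0} (X − w_l)²` is `≥ 0` on the `v_j`, vanishes on the `w_l`, and has top coefficient `1`, forcing `D ≤ 0`.  (5) Hence `Q(v_0)` has the sign `(−1)^{t+2}`, alternation
gives `Q(v_{t+1}) < 0`, so some `w_l > v_{t+1}`; the `t + 1` roots of `Q` in the gaps of `v` are then `w_0 < ⋯ < w_t`.
DEDUP DISCLOSURE (`rg -n 'kernel|shift' Summits/Ventures/HSemireg/WedgeHankelRecurrenceGauss*`, 2026-09-02): N267 has the OTHER interlacing (`t + 1` shifted nodes against `t + 2` nodes);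
nothing on equal orders.  The 11 names below: 0 hits tree-wide.

WHAT IS IN THE TREE.  N239 `exists_root_Ioo_of_mul_eval_neg`; N262 `sum_mul_eval_eq_of_moments_eq`, `eval_gapPoly_mul_eval_gapPoly_pos`; N264 `exists_node_le_gaussNode_zero`; N265
`gauss_weight_pos`; N266 `sum_mul_pow_lt_of_moments_eq`; N267 `sum_mul_sub_mul_pow_eq_of_moments`; Mathlib `Fintype.sum_eq_add`, `StrictMono.range_inj`, `Fin.lastCases`,
`Fintype.card_le_of_injective`.
THIS FILE (namespace `Summit.Ventures.HSemireg.Wedge.HankelOuter` continued; CHAINED on N267; 0 definitions):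
* §1033 `sum_mul_eval_sub_eq_coeff_mul_sub` (step 1), `sum_pair_eq_zero_of_shift_moments_eq` (step 2), `forall_eval_shiftNodePoly_ne_zero` + `eval_shiftNodePoly_eq_zero_iff_succ` (step 3),
  `eval_shiftNodePoly_mul_succ_neg` (strict alternation), `gaussNode_zero_lt_shiftNode_zero` (step 4), `neg_one_pow_mul_eval_shiftNodePoly_pos`, `gaussNode_last_lt_shiftNode_last` (step 5),
  **`gauss_kernel_nodes_interlace`** (`v_i < w_i` for all `i ≤ t + 1` and `w_i < v_{i+1}` for `i ≤ t`), `exists_node_ne_of_lt_card` (pigeonhole), **`gauss_kernel_nodes_interlace_of_moments`**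
  (MEASURE-LEVEL: `(μ, v)` and `(ν, w)` the `(t+2)`-point Gauss rules of a positive `(M, V)` with `≥ t + 3` distinct nodes `> c` and of `(x − c)·(M, V)`).
CAVEATS.  Discrete integrating representation only; nothing Ext-side.  New names only.
-/

open Module Polynomial
open scoped Matrix Polynomial

namespace Summit.Ventures.HSemireg.Wedge.HankelOuter

/-! ## §1033. Kernel-polynomial nodes -/

/-- **Step 1 — the two functionals differ by the top coefficient times the defect**: if `Σ_j a_j x_j^p = Σ_l b_l y_l^p` for `p ≤ N` then for `deg F ≤ N + 1`
`Σ_l b_l F(y_l) − Σ_j a_j F(x_j) = [X^{N+1}]F · (Σ_l b_l y_l^{N+1} − Σ_j a_j x_j^{N+1})`. [bookkeeping; this file, §1033] -/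
theorem sum_mul_eval_sub_eq_coeff_mul_sub {m m' N : ℕ} {a x : Fin m → ℝ} {b y : Fin m' → ℝ} (h : ∀ p, p ≤ N → ∑ j, a j * x j ^ p = ∑ l, b l * y l ^ p)
    {F : ℝ[X]} (hF : F.natDegree ≤ N + 1) :
    ∑ l, b l * F.eval (y l) - ∑ j, a j * F.eval (x j) = F.coeff (N + 1) * (∑ l, b l * y l ^ (N + 1) - ∑ j, a j * x j ^ (N + 1)) := by
  set c := F.coeff (N + 1) with hc
  have hG : (F - C c * Polynomial.X ^ (N + 1)).natDegree < N + 1 := by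
    refine Nat.lt_succ_of_le ((natDegree_le_iff_coeff_eq_zero).2 fun M hM => ?_)
    rw [coeff_sub, coeff_C_mul, coeff_X_pow]
    rcases (show M = N + 1 ∨ N + 1 < M by omega) with h1 | h1
    · subst h1; rw [if_pos rfl, mul_one, hc, sub_self]
    · rw [if_neg (by omega), mul_zero, sub_zero]; exact coeff_eq_zero_of_natDegree_lt (by omega)
  have hq := sum_mul_eval_eq_of_moments_eq (N := N + 1) (fun p hp => h p (by omega)) hG
  simp only [eval_sub, eval_mul, eval_C, eval_pow, eval_X, mul_sub, Finset.sum_sub_distrib] at hq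
  have h1 : ∑ j, a j * (c * x j ^ (N + 1)) = c * ∑ j, a j * x j ^ (N + 1) := by rw [Finset.mul_sum]; exact Finset.sum_congr rfl fun j _ => by ring
  have h2 : ∑ l, b l * (c * y l ^ (N + 1)) = c * ∑ l, b l * y l ^ (N + 1) := by rw [Finset.mul_sum]; exact Finset.sum_congr rfl fun l _ => by ring
  rw [h1, h2] at hq
  linarith

/-- **Step 2 — the two-term relation**: with `Q = ∏_l (X − w_l)`, the gap polynomial `r_k = ∏_{j ≠ k, k+1} (X − v_j)` and equal shifted moments up to `2t + 2`,
`μ_k (v_k − c) Q(v_k) r_k(v_k) + μ_{k+1} (v_{k+1} − c) Q(v_{k+1}) r_k(v_{k+1}) = 0`. [Chihara I §7, mechanism; this file, §1033] -/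
theorem sum_pair_eq_zero_of_shift_moments_eq {t : ℕ} {μ v ν w : Fin (t + 2) → ℝ} {c : ℝ}
    (hmom : ∀ p, p ≤ 2 * t + 2 → ∑ l, ν l * w l ^ p = ∑ j, (μ j * (v j - c)) * v j ^ p) (k : Fin (t + 1)) :
    (μ k.castSucc * (v k.castSucc - c)) * ((∏ l, (Polynomial.X - C (w l))).eval (v k.castSucc)
        * (∏ j ∈ Finset.univ.filter (fun j : Fin (t + 2) => j ≠ k.castSucc ∧ j ≠ k.succ), (Polynomial.X - C (v j))).eval (v k.castSucc))
      + (μ k.succ * (v k.succ - c)) * ((∏ l, (Polynomial.X - C (w l))).eval (v k.succ)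
        * (∏ j ∈ Finset.univ.filter (fun j : Fin (t + 2) => j ≠ k.castSucc ∧ j ≠ k.succ), (Polynomial.X - C (v j))).eval (v k.succ)) = 0 := by
  classical
  set Q : ℝ[X] := ∏ l, (Polynomial.X - C (w l)) with hQ
  set r : ℝ[X] := ∏ j ∈ Finset.univ.filter (fun j : Fin (t + 2) => j ≠ k.castSucc ∧ j ≠ k.succ), (Polynomial.X - C (v j)) with hr
  have hQdeg : Q.natDegree = t + 2 := by
    rw [hQ, natDegree_prod_of_monic _ _ fun l _ => monic_X_sub_C (w l)]
    simp only [natDegree_X_sub_C, Finset.sum_const, Finset.card_univ, Fintype.card_fin, smul_eq_mul, mul_one]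
  have hne : k.castSucc ≠ k.succ := (Fin.castSucc_lt_succ (i := k)).ne
  have hcard : (Finset.univ.filter (fun j : Fin (t + 2) => j ≠ k.castSucc ∧ j ≠ k.succ)).card = t := by
    have h1 : Finset.univ.filter (fun j : Fin (t + 2) => j ≠ k.castSucc ∧ j ≠ k.succ) = (Finset.univ.erase k.castSucc).erase k.succ := by
      ext j; simp only [Finset.mem_filter, Finset.mem_univ, true_and, Finset.mem_erase]; tauto
    rw [h1, Finset.card_erase_of_mem (Finset.mem_erase.2 ⟨hne.symm, Finset.mem_univ _⟩), Finset.card_erase_of_mem (Finset.mem_univ _), Finset.card_univ, Fintype.card_fin]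
    rfl
  have hrdeg : r.natDegree = t := by
    rw [hr, natDegree_prod_of_monic _ _ fun j _ => monic_X_sub_C (v j)]
    simp only [natDegree_X_sub_C, Finset.sum_const, hcard, smul_eq_mul, mul_one]
  have hdeg : (Q * r).natDegree < 2 * t + 3 := by
    rw [natDegree_mul (monic_prod_of_monic _ _ fun l _ => monic_X_sub_C (w l)).ne_zero (monic_prod_of_monic _ _ fun j _ => monic_X_sub_C (v j)).ne_zero, hQdeg, hrdeg]
    omega
  -- `(ν, w)` integrates `Q r` to zero; the weighted `v`-side keeps only the two adjacent nodes
  have hquad := sum_mul_eval_eq_of_moments_eq (N := 2 * t + 3) (ν := fun j => μ j * (v j - c)) (fun p hp => hmom p (by omega)) hdeg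
  have hzero : ∑ l, ν l * (Q * r).eval (w l) = 0 := by
    refine Finset.sum_eq_zero fun l _ => ?_
    have hQ0 : Q.eval (w l) = 0 := by rw [hQ, eval_prod]; exact Finset.prod_eq_zero (Finset.mem_univ l) (by simp)
    rw [eval_mul, hQ0, zero_mul, mul_zero]
  rw [hzero] at hquad
  have hbig : ∑ j, (μ j * (v j - c)) * (Q * r).eval (v j) = (μ k.castSucc * (v k.castSucc - c)) * (Q * r).eval (v k.castSucc) + (μ k.succ * (v k.succ - c)) * (Q * r).eval (v k.succ) := by
    refine Fintype.sum_eq_add _ _ hne fun j hj => ?_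
    have hr0 : r.eval (v j) = 0 := by
      rw [hr, eval_prod]; exact Finset.prod_eq_zero (Finset.mem_filter.2 ⟨Finset.mem_univ j, hj⟩) (by simp)
    rw [eval_mul, hr0, mul_zero, mul_zero]
  have h := hquad.symm
  rw [hbig, eval_mul, eval_mul] at h
  linarith

/-- **Step 3a — vanishing propagates**: under the two-term relations with `μ_j (v_j − c) > 0`, `Q(v_k) = 0 ⟺ Q(v_{k+1}) = 0`. [mechanism; this file, §1033] -/
theorem eval_shiftNodePoly_eq_zero_iff_succ {t : ℕ} {μ v ν w : Fin (t + 2) → ℝ} {c : ℝ} (hμ : ∀ j, 0 < μ j) (hv : StrictMono v) (hcv : ∀ j, c < v j)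
    (hmom : ∀ p, p ≤ 2 * t + 2 → ∑ l, ν l * w l ^ p = ∑ j, (μ j * (v j - c)) * v j ^ p) (k : Fin (t + 1)) :
    (∏ l, (Polynomial.X - C (w l))).eval (v k.castSucc) = 0 ↔ (∏ l, (Polynomial.X - C (w l))).eval (v k.succ) = 0 := by
  have hrel := sum_pair_eq_zero_of_shift_moments_eq hmom k
  have hrr := eval_gapPoly_mul_eval_gapPoly_pos hv k
  have hra : (∏ j ∈ Finset.univ.filter (fun j : Fin (t + 2) => j ≠ k.castSucc ∧ j ≠ k.succ), (Polynomial.X - C (v j))).eval (v k.castSucc) ≠ 0 :=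
    fun h => by rw [h, zero_mul] at hrr; exact lt_irrefl _ hrr
  have hrb : (∏ j ∈ Finset.univ.filter (fun j : Fin (t + 2) => j ≠ k.castSucc ∧ j ≠ k.succ), (Polynomial.X - C (v j))).eval (v k.succ) ≠ 0 :=
    fun h => by rw [h, mul_zero] at hrr; exact lt_irrefl _ hrr
  have hwa : μ k.castSucc * (v k.castSucc - c) ≠ 0 := (mul_pos (hμ _) (sub_pos.2 (hcv _))).ne'
  have hwb : μ k.succ * (v k.succ - c) ≠ 0 := (mul_pos (hμ _) (sub_pos.2 (hcv _))).ne'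
  constructor
  · intro h0
    rw [h0, zero_mul, mul_zero, zero_add] at hrel
    rcases mul_eq_zero.1 hrel with h | h
    · exact absurd h hwb
    · rcases mul_eq_zero.1 h with h | h
      · exact h
      · exact absurd h hrb
  · intro h0
    rw [h0, zero_mul, mul_zero, add_zero] at hrel
    rcases mul_eq_zero.1 hrel with h | h
    · exact absurd h hwa
    · rcases mul_eq_zero.1 h with h | h
      · exact h
      · exact absurd h hra

/-- **Step 3b — no `Q(v_j)` vanishes**: otherwise all of them would (propagation), and `F = Q · X^{t+1}` (top coefficient `1`, killed by both functionals) would force the defect to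
vanish. [mechanism; this file, §1033] -/
theorem forall_eval_shiftNodePoly_ne_zero {t : ℕ} {μ v ν w : Fin (t + 2) → ℝ} {c : ℝ} (hμ : ∀ j, 0 < μ j) (hv : StrictMono v) (hcv : ∀ j, c < v j)
    (hmom : ∀ p, p ≤ 2 * t + 2 → ∑ l, ν l * w l ^ p = ∑ j, (μ j * (v j - c)) * v j ^ p)
    (hdef : ∑ j, (μ j * (v j - c)) * v j ^ (2 * t + 3) < ∑ l, ν l * w l ^ (2 * t + 3)) (i : Fin (t + 2)) :
    (∏ l, (Polynomial.X - C (w l))).eval (v i) ≠ 0 := by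
  set Q : ℝ[X] := ∏ l, (Polynomial.X - C (w l)) with hQ
  intro hi
  have hiff : ∀ j : Fin (t + 2), Q.eval (v j) = 0 ↔ Q.eval (v 0) = 0 := fun j =>
    Fin.induction (motive := fun j : Fin (t + 2) => Q.eval (v j) = 0 ↔ Q.eval (v 0) = 0) Iff.rfl
      (fun j ih => (eval_shiftNodePoly_eq_zero_iff_succ hμ hv hcv hmom j).symm.trans ih) j
  have hall : ∀ j : Fin (t + 2), Q.eval (v j) = 0 := fun j => (hiff j).2 ((hiff i).1 hi)
  -- test polynomial `Q · X^{t+1}`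
  have hQm : Q.Monic := monic_prod_of_monic _ _ fun l _ => monic_X_sub_C (w l)
  have hQdeg : Q.natDegree = t + 2 := by
    rw [hQ, natDegree_prod_of_monic _ _ fun l _ => monic_X_sub_C (w l)]
    simp only [natDegree_X_sub_C, Finset.sum_const, Finset.card_univ, Fintype.card_fin, smul_eq_mul, mul_one]
  have hFm : (Q * Polynomial.X ^ (t + 1)).Monic := hQm.mul (monic_X_pow _)
  have hFdeg : (Q * Polynomial.X ^ (t + 1)).natDegree = 2 * t + 3 := by
    rw [hQm.natDegree_mul (monic_X_pow _), hQdeg, natDegree_X_pow]; ring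
  have hstep := sum_mul_eval_sub_eq_coeff_mul_sub (N := 2 * t + 2) (a := fun j => μ j * (v j - c)) (fun p hp => (hmom p hp).symm) (F := Q * Polynomial.X ^ (t + 1)) hFdeg.le
  have hcoef : (Q * Polynomial.X ^ (t + 1)).coeff (2 * t + 2 + 1) = 1 := by
    rw [show 2 * t + 2 + 1 = 2 * t + 3 by ring, ← hFdeg]; exact hFm.coeff_natDegree
  have h1 : ∑ l, ν l * (Q * Polynomial.X ^ (t + 1)).eval (w l) = 0 := Finset.sum_eq_zero fun l _ => by
    have : Q.eval (w l) = 0 := by rw [hQ, eval_prod]; exact Finset.prod_eq_zero (Finset.mem_univ l) (by simp)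
    rw [eval_mul, this, zero_mul, mul_zero]
  have h2 : ∑ j, (μ j * (v j - c)) * (Q * Polynomial.X ^ (t + 1)).eval (v j) = 0 := Finset.sum_eq_zero fun j _ => by
    rw [eval_mul, hall j, zero_mul, mul_zero]
  rw [h1, h2, hcoef, one_mul, show 2 * t + 2 + 1 = 2 * t + 3 by ring] at hstep
  linarith

/-- **Strict alternation of `Q` along the nodes `v`**: `Q(v_k) · Q(v_{k+1}) < 0`. [Chihara I §7; this file, §1033] -/
theorem eval_shiftNodePoly_mul_succ_neg {t : ℕ} {μ v ν w : Fin (t + 2) → ℝ} {c : ℝ} (hμ : ∀ j, 0 < μ j) (hv : StrictMono v) (hcv : ∀ j, c < v j)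
    (hmom : ∀ p, p ≤ 2 * t + 2 → ∑ l, ν l * w l ^ p = ∑ j, (μ j * (v j - c)) * v j ^ p)
    (hdef : ∑ j, (μ j * (v j - c)) * v j ^ (2 * t + 3) < ∑ l, ν l * w l ^ (2 * t + 3)) (k : Fin (t + 1)) :
    (∏ l, (Polynomial.X - C (w l))).eval (v k.castSucc) * (∏ l, (Polynomial.X - C (w l))).eval (v k.succ) < 0 := by
  have hrel := sum_pair_eq_zero_of_shift_moments_eq hmom k
  have hrr := eval_gapPoly_mul_eval_gapPoly_pos hv k
  have ha := forall_eval_shiftNodePoly_ne_zero hμ hv hcv hmom hdef k.castSucc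
  have hb := forall_eval_shiftNodePoly_ne_zero hμ hv hcv hmom hdef k.succ
  set qa := (∏ l, (Polynomial.X - C (w l))).eval (v k.castSucc)
  set qb := (∏ l, (Polynomial.X - C (w l))).eval (v k.succ)
  set ra := (∏ j ∈ Finset.univ.filter (fun j : Fin (t + 2) => j ≠ k.castSucc ∧ j ≠ k.succ), (Polynomial.X - C (v j))).eval (v k.castSucc)
  set rb := (∏ j ∈ Finset.univ.filter (fun j : Fin (t + 2) => j ≠ k.castSucc ∧ j ≠ k.succ), (Polynomial.X - C (v j))).eval (v k.succ)
  set wa := μ k.castSucc * (v k.castSucc - c)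
  set wb := μ k.succ * (v k.succ - c)
  have hwa : 0 < wa := mul_pos (hμ _) (sub_pos.2 (hcv _))
  have hwb : 0 < wb := mul_pos (hμ _) (sub_pos.2 (hcv _))
  have hsq : 0 < (wb * (qb * rb)) ^ 2 := by
    have hne : wb * (qb * rb) ≠ 0 := mul_ne_zero hwb.ne' (mul_ne_zero hb fun h => by rw [h, mul_zero] at hrr; exact lt_irrefl _ hrr)
    positivity
  have hid : (qa * qb) * (ra * rb * (wa * wb)) = -(wb * (qb * rb)) ^ 2 := by
    have h1 : wa * (qa * ra) = -(wb * (qb * rb)) := by linarith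
    linear_combination (wb * (qb * rb)) * h1
  have hneg : (qa * qb) * (ra * rb * (wa * wb)) < 0 := by rw [hid]; linarith
  have hpos : 0 < ra * rb * (wa * wb) := mul_pos hrr (mul_pos hwa hwb)
  by_contra hcon
  exact absurd hneg (not_lt.2 (mul_nonneg (not_lt.1 hcon) hpos.le))

/-- **Step 4 — the first node moves right: `v_0 < w_0`.**  Otherwise `F = (X − w_0) ∏_{l ≠ 0} (X − w_l)²` (top coefficient `1`) vanishes on the `w_l` and is `≥ 0` on the `v_j`, so
the defect would be `≤ 0`. [Chihara I §7; this file, §1033] -/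
theorem gaussNode_zero_lt_shiftNode_zero {t : ℕ} {μ v ν w : Fin (t + 2) → ℝ} {c : ℝ} (hμ : ∀ j, 0 < μ j) (hv : StrictMono v) (hcv : ∀ j, c < v j)
    (hmom : ∀ p, p ≤ 2 * t + 2 → ∑ l, ν l * w l ^ p = ∑ j, (μ j * (v j - c)) * v j ^ p)
    (hdef : ∑ j, (μ j * (v j - c)) * v j ^ (2 * t + 3) < ∑ l, ν l * w l ^ (2 * t + 3)) : v 0 < w 0 := by
  classical
  by_contra hle
  rw [not_lt] at hle
  set F : ℝ[X] := (Polynomial.X - C (w 0)) * ∏ l ∈ Finset.univ.erase (0 : Fin (t + 2)), (Polynomial.X - C (w l)) ^ 2 with hF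
  have hPm : (∏ l ∈ Finset.univ.erase (0 : Fin (t + 2)), (Polynomial.X - C (w l)) ^ 2).Monic := monic_prod_of_monic _ _ fun l _ => (monic_X_sub_C (w l)).pow 2
  have hPdeg : (∏ l ∈ Finset.univ.erase (0 : Fin (t + 2)), (Polynomial.X - C (w l)) ^ 2).natDegree = 2 * t + 2 := by
    rw [natDegree_prod_of_monic _ _ fun l _ => (monic_X_sub_C (w l)).pow 2]
    simp only [(monic_X_sub_C _).natDegree_pow, natDegree_X_sub_C, Finset.sum_const, Finset.card_erase_of_mem (Finset.mem_univ _), Finset.card_univ,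
      Fintype.card_fin, smul_eq_mul]
    omega
  have hFm : F.Monic := (monic_X_sub_C (w 0)).mul hPm
  have hFdeg : F.natDegree = 2 * t + 3 := by
    rw [hF, (monic_X_sub_C (w 0)).natDegree_mul hPm, natDegree_X_sub_C, hPdeg]; ring
  have hstep := sum_mul_eval_sub_eq_coeff_mul_sub (N := 2 * t + 2) (a := fun j => μ j * (v j - c)) (fun p hp => (hmom p hp).symm) (F := F) hFdeg.le
  have hcoef : F.coeff (2 * t + 2 + 1) = 1 := by
    rw [show 2 * t + 2 + 1 = 2 * t + 3 by ring, ← hFdeg]; exact hFm.coeff_natDegree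
  -- `F` vanishes on the `w_l`
  have h1 : ∑ l, ν l * F.eval (w l) = 0 := Finset.sum_eq_zero fun l _ => by
    have : F.eval (w l) = 0 := by
      rcases eq_or_ne l 0 with rfl | hl
      · rw [hF, eval_mul, eval_sub, eval_X, eval_C, sub_self, zero_mul]
      · rw [hF, eval_mul, eval_prod]
        rw [Finset.prod_eq_zero (Finset.mem_erase.2 ⟨hl, Finset.mem_univ l⟩) (by rw [eval_pow, eval_sub, eval_X, eval_C, sub_self, zero_pow two_ne_zero]), mul_zero]
    rw [this, mul_zero]
  -- `F ≥ 0` on the `v_j`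
  have h2 : 0 ≤ ∑ j, (μ j * (v j - c)) * F.eval (v j) := by
    refine Finset.sum_nonneg fun j _ => mul_nonneg (mul_pos (hμ j) (sub_pos.2 (hcv j))).le ?_
    rw [hF, eval_mul, eval_prod]
    refine mul_nonneg ?_ (Finset.prod_nonneg fun l _ => by rw [eval_pow]; exact sq_nonneg _)
    rw [eval_sub, eval_X, eval_C, sub_nonneg]
    exact hle.trans (hv.monotone (Fin.zero_le j))
  rw [h1, hcoef, one_mul, show 2 * t + 2 + 1 = 2 * t + 3 by ring] at hstep
  linarith

/-- **Step 5a — the sign of `Q` along `v`**: `(−1)^{t + i} Q(v_i) > 0` for every `i ≤ t + 1` (at `i = 0` all `t + 2` factors `v_0 − w_l` are negative; then alternate).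
[mechanism; this file, §1033] -/
theorem neg_one_pow_mul_eval_shiftNodePoly_pos {t : ℕ} {μ v ν w : Fin (t + 2) → ℝ} {c : ℝ} (hμ : ∀ j, 0 < μ j) (hv : StrictMono v) (hcv : ∀ j, c < v j) (hw : StrictMono w)
    (hmom : ∀ p, p ≤ 2 * t + 2 → ∑ l, ν l * w l ^ p = ∑ j, (μ j * (v j - c)) * v j ^ p)
    (hdef : ∑ j, (μ j * (v j - c)) * v j ^ (2 * t + 3) < ∑ l, ν l * w l ^ (2 * t + 3)) (i : Fin (t + 2)) :
    0 < (-1 : ℝ) ^ (t + (i : ℕ)) * (∏ l, (Polynomial.X - C (w l))).eval (v i) := by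
  set Q : ℝ[X] := ∏ l, (Polynomial.X - C (w l)) with hQ
  have h0 : 0 < (-1 : ℝ) ^ (t + ((0 : Fin (t + 2)) : ℕ)) * Q.eval (v 0) := by
    have hv0 := gaussNode_zero_lt_shiftNode_zero hμ hv hcv hmom hdef
    rw [Fin.val_zero, add_zero, hQ, eval_prod]
    have : ∏ l, (Polynomial.X - C (w l)).eval (v 0) = ∏ l : Fin (t + 2), ((-1 : ℝ) * (w l - v 0)) := Finset.prod_congr rfl fun l _ => by
      rw [eval_sub, eval_X, eval_C]; ring
    rw [this, Finset.prod_mul_distrib, Finset.prod_const, Finset.card_univ, Fintype.card_fin, ← mul_assoc, ← pow_add,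
      show t + (t + 2) = 2 * (t + 1) by ring, pow_mul, neg_one_sq, one_pow, one_mul]
    exact Finset.prod_pos fun l _ => sub_pos.2 (lt_of_lt_of_le hv0 (hw.monotone (Fin.zero_le l)))
  refine Fin.induction (motive := fun i : Fin (t + 2) => 0 < (-1 : ℝ) ^ (t + (i : ℕ)) * Q.eval (v i)) h0 (fun i ih => ?_) i
  have halt := eval_shiftNodePoly_mul_succ_neg hμ hv hcv hmom hdef i
  rw [Fin.val_succ, ← add_assoc, pow_succ]
  -- `(−1)^{t+i} Q(v_i) > 0` and `Q(v_i) Q(v_{i+1}) < 0` ⇒ `(−1)^{t+i+1} Q(v_{i+1}) > 0`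
  have hsq : (-1 : ℝ) ^ (t + (i : ℕ)) * (-1 : ℝ) ^ (t + (i : ℕ)) = 1 := by rw [← pow_add, ← two_mul, pow_mul, neg_one_sq, one_pow]
  rw [Fin.val_castSucc] at ih
  nlinarith [ih, halt, hsq, mul_pos ih ih]

/-- **Step 5b — the last node moves right: `v_{t+1} < w_{t+1}`** (`Q(v_{t+1}) < 0`, so some factor `v_{t+1} − w_l` is negative). [Chihara I §7; this file, §1033] -/
theorem gaussNode_last_lt_shiftNode_last {t : ℕ} {μ v ν w : Fin (t + 2) → ℝ} {c : ℝ} (hμ : ∀ j, 0 < μ j) (hv : StrictMono v) (hcv : ∀ j, c < v j) (hw : StrictMono w)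
    (hmom : ∀ p, p ≤ 2 * t + 2 → ∑ l, ν l * w l ^ p = ∑ j, (μ j * (v j - c)) * v j ^ p)
    (hdef : ∑ j, (μ j * (v j - c)) * v j ^ (2 * t + 3) < ∑ l, ν l * w l ^ (2 * t + 3)) : v (Fin.last (t + 1)) < w (Fin.last (t + 1)) := by
  have h := neg_one_pow_mul_eval_shiftNodePoly_pos hμ hv hcv hw hmom hdef (Fin.last (t + 1))
  rw [Fin.val_last, show t + (t + 1) = 2 * t + 1 by ring, pow_succ, pow_mul, neg_one_sq, one_pow, one_mul, eval_prod] at h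
  have hneg : ∏ l, (Polynomial.X - C (w l)).eval (v (Fin.last (t + 1))) < 0 := by linarith
  by_contra hle
  rw [not_lt] at hle
  refine absurd hneg (not_lt.2 (Finset.prod_nonneg fun l _ => ?_))
  rw [eval_sub, eval_X, eval_C, sub_nonneg]
  exact (hw.monotone (Fin.le_last l)).trans hle

/-- **CHRISTOFFEL'S KERNEL-POLYNOMIAL NODES INTERLACE FROM THE RIGHT.**  If `Σ_l ν_l w_l^p = Σ_j μ_j (v_j − c) v_j^p` for `p ≤ 2t + 2` and
`Σ_j μ_j (v_j − c) v_j^{2t+3} < Σ_l ν_l w_l^{2t+3}`, with `μ_j > 0`, `c < v_j` and `v, w : Fin (t+2) → ℝ` strictly increasing, then `v_i < w_i` for all `i` and `w_i < v_{i+1}` for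
`i ≤ t`: `v_0 < w_0 < v_1 < ⋯ < v_{t+1} < w_{t+1}`. [Chihara I §7 (zeros of kernel polynomials); Szegő Thm 2.5 + §3.3; this file, §1033] -/
theorem gauss_kernel_nodes_interlace {t : ℕ} {μ v ν w : Fin (t + 2) → ℝ} {c : ℝ} (hμ : ∀ j, 0 < μ j) (hv : StrictMono v) (hcv : ∀ j, c < v j) (hw : StrictMono w)
    (hmom : ∀ p, p ≤ 2 * t + 2 → ∑ l, ν l * w l ^ p = ∑ j, (μ j * (v j - c)) * v j ^ p)
    (hdef : ∑ j, (μ j * (v j - c)) * v j ^ (2 * t + 3) < ∑ l, ν l * w l ^ (2 * t + 3)) :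
    (∀ i : Fin (t + 2), v i < w i) ∧ ∀ i : Fin (t + 1), w i.castSucc < v i.succ := by
  classical
  have hlast := gaussNode_last_lt_shiftNode_last hμ hv hcv hw hmom hdef
  -- a root of `Q` in each gap of `v`
  have hgap : ∀ i : Fin (t + 1), ∃ z, v i.castSucc < z ∧ z < v i.succ ∧ (∏ l, (Polynomial.X - C (w l))).IsRoot z := fun i =>
    exists_root_Ioo_of_mul_eval_neg (hv (Fin.castSucc_lt_succ (i := i))) (eval_shiftNodePoly_mul_succ_neg hμ hv hcv hmom hdef i)
  choose z hz1 hz2 hz3 using hgap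
  have hzmono : StrictMono z := by
    refine Fin.strictMono_iff_lt_succ.2 fun i => ?_
    calc z i.castSucc < v i.castSucc.succ := hz2 _
      _ = v i.succ.castSucc := by rw [Fin.succ_castSucc]
      _ < z i.succ := hz1 _
  -- each `z_i` is one of `w_0, …, w_t` (it is a root `< v_{t+1} < w_{t+1}`)
  have hzmem : ∀ i, z i ∈ Set.range (w ∘ Fin.castSucc) := fun i => by
    have h := hz3 i
    rw [IsRoot.def, eval_prod, Finset.prod_eq_zero_iff] at h
    obtain ⟨l, -, hl⟩ := h
    rw [eval_sub, eval_X, eval_C, sub_eq_zero] at hl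
    have hlt : z i < w (Fin.last (t + 1)) := lt_trans (lt_of_lt_of_le (hz2 i) (hv.monotone (Fin.le_last _))) hlast
    have hl' : l ≠ Fin.last (t + 1) := fun h => by rw [h] at hl; exact (hl ▸ hlt).false
    exact ⟨l.castPred hl', by simp [hl]⟩
  have hwc : StrictMono (w ∘ Fin.castSucc) := hw.comp Fin.strictMono_castSucc
  have hrange : Set.range z = Set.range (w ∘ Fin.castSucc) := by
    have hsub : Finset.univ.image z ⊆ Finset.univ.image (w ∘ Fin.castSucc) := by
      intro x hx
      obtain ⟨i, -, rfl⟩ := Finset.mem_image.1 hx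
      obtain ⟨j, hj⟩ := hzmem i
      exact Finset.mem_image.2 ⟨j, Finset.mem_univ _, hj⟩
    have hcard : (Finset.univ.image (w ∘ Fin.castSucc)).card ≤ (Finset.univ.image z).card := by
      rw [Finset.card_image_of_injective _ hwc.injective, Finset.card_image_of_injective _ hzmono.injective]
    have heq := Finset.eq_of_subset_of_card_le hsub hcard
    rw [← Set.image_univ, ← Set.image_univ, ← Finset.coe_univ, ← Finset.coe_image, ← Finset.coe_image, heq]
  have hzw : z = w ∘ Fin.castSucc := (hzmono.range_inj hwc).1 hrange
  have hmid : ∀ i : Fin (t + 1), v i.castSucc < w i.castSucc ∧ w i.castSucc < v i.succ := fun i => by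
    have h1 := hz1 i; have h2 := hz2 i
    rw [hzw] at h1 h2
    exact ⟨h1, h2⟩
  refine ⟨fun i => ?_, fun i => (hmid i).2⟩
  exact Fin.lastCases hlast (fun i => (hmid i).1) i

/-- **Pigeonhole**: an injective family with more members than `t + 2` has a member outside any `(t+2)`-family. [bookkeeping; this file, §1033] -/
theorem exists_node_ne_of_lt_card {n P : ℕ} {v : Fin n → ℝ} {V : Fin P → ℝ} (hV : Function.Injective V) (hP : n < P) : ∃ l, ∀ j, V l ≠ v j := by
  by_contra h
  simp only [not_exists, not_forall, ne_eq, not_not] at h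
  choose g hg using h
  have hginj : Function.Injective g := fun l l' hll' => hV (by rw [hg l, hg l', hll'])
  have := Fintype.card_le_of_injective g hginj
  simp only [Fintype.card_fin] at this
  omega

/-- **KERNEL-POLYNOMIAL NODES — measure-level statement.**  Let `(M, V)` be a positive discrete measure with at least `t + 3` distinct nodes, all `> c`; let `(μ, v)` and `(ν, w)` be the
`(t+2)`-point Gauss rules of `(M, V)` and of `(x − c)·(M, V)` (exact in degree `≤ 2t + 3`), with strictly increasing nodes.  Then `v_0 < w_0 < v_1 < ⋯ < v_{t+1} < w_{t+1}`; positivity of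
`μ` (N265), `c < v_0` (N264) and the strict defect (N266) are derived. [Chihara I §7; Szegő Thm 2.5; this file, §1033] -/
theorem gauss_kernel_nodes_interlace_of_moments {t P : ℕ} {μ v ν w : Fin (t + 2) → ℝ} {M V : Fin P → ℝ} {c : ℝ} (hM : ∀ l, 0 < M l) (hV : Function.Injective V)
    (hP : t + 3 ≤ P) (hcV : ∀ l, c < V l) (hv : StrictMono v) (hw : StrictMono w) (hA : ∀ p, p ≤ 2 * t + 3 → ∑ j, μ j * v j ^ p = ∑ l, M l * V l ^ p)
    (hB : ∀ p, p ≤ 2 * t + 3 → ∑ l, ν l * w l ^ p = ∑ l, (M l * (V l - c)) * V l ^ p) :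
    (∀ i : Fin (t + 2), v i < w i) ∧ ∀ i : Fin (t + 1), w i.castSucc < v i.succ := by
  have hμ : ∀ j, 0 < μ j := gauss_weight_pos (t := t + 1) hv.injective hM hV (by omega) (fun p hp => hA p (by omega))
  obtain ⟨l₀, hl₀⟩ := exists_node_le_gaussNode_zero (t := t + 1) hμ hv hM (fun p hp => hA p (by omega))
  have hcv : ∀ j, c < v j := fun j => lt_of_lt_of_le (lt_of_lt_of_le (hcV l₀) hl₀) (hv.monotone (Fin.zero_le j))
  have hmom : ∀ p, p ≤ 2 * t + 2 → ∑ l, ν l * w l ^ p = ∑ j, (μ j * (v j - c)) * v j ^ p := fun p hp => by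
    rw [hB p (by omega)]; exact sum_mul_sub_mul_pow_eq_of_moments (N := 2 * t + 2) hA hp
  -- the defect: `D = Σ M V^{2t+4} − Σ μ v^{2t+4} > 0`
  obtain ⟨l₁, hl₁⟩ := exists_node_ne_of_lt_card (v := v) hV (by omega)
  have hlt := sum_mul_pow_lt_of_moments_eq (t := t + 1) (fun l => (hM l).le) (hM l₁) hl₁ (fun p hp => hA p (by omega))
  have hdef : ∑ j, (μ j * (v j - c)) * v j ^ (2 * t + 3) < ∑ l, ν l * w l ^ (2 * t + 3) := by
    rw [hB _ le_rfl]
    have e1 : ∑ l, (M l * (V l - c)) * V l ^ (2 * t + 3) = ∑ l, M l * V l ^ (2 * (t + 1) + 2) - c * ∑ l, M l * V l ^ (2 * t + 3) := by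
      rw [Finset.mul_sum, ← Finset.sum_sub_distrib]
      exact Finset.sum_congr rfl fun l _ => by rw [show 2 * (t + 1) + 2 = 2 * t + 3 + 1 by ring, pow_succ]; ring
    have e2 : ∑ j, (μ j * (v j - c)) * v j ^ (2 * t + 3) = ∑ j, μ j * v j ^ (2 * (t + 1) + 2) - c * ∑ j, μ j * v j ^ (2 * t + 3) := by
      rw [Finset.mul_sum, ← Finset.sum_sub_distrib]
      exact Finset.sum_congr rfl fun j _ => by rw [show 2 * (t + 1) + 2 = 2 * t + 3 + 1 by ring, pow_succ]; ring
    rw [e1, e2, hA _ le_rfl]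
    linarith
  exact gauss_kernel_nodes_interlace hμ hv hcv hw hmom hdef

end Summit.Ventures.HSemireg.Wedge.HankelOuter
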